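import Summits.MatrixMultiplication.OmegaCensus.STPPVosperSlackOneCoverStepsE
import Summits.MatrixMultiplication.OmegaCensus.STPPVosperSlackOnePairingSteps

/-!
# ω-census (abelian STPP census): the slack-1 `a = 2` cover+words law over any sound block enumerator WITH THE A-PAIRING OF `W` (kernel)

HONEST FRAMING (pub-omega census; verbatim): lottery ticket; floor = certified bounds/negative ranges.
Census STRUCTURE (seat pub-omega-stpp-2 gen 26, 2026-08-28), family (b2).  Seat stpp-1 gen 32's `no_isSTPP_of_slack_one_coverE_prime_a2` (`…LawA2E.lean`) VERBATIM
— cases γ / α₂ / β, escapes `existsCoverW … = false` over a sound enumerator `bd` — with ONE MORE PREMISE offered to every table hypothesis: the A-PAIRING of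
`W = {c − a − b} = Cᵢ + (−Aᵢ) − Bᵢ`, a disjoint union of `|Cᵢ|` translates of the combined pattern `{ε·j − δ}` (`STPPVosperSlackOnePairing.lean`,
`coverByF_blockSum`, UNCONDITIONAL): the window complement of the row passes `coverByF p (patN p j a ·) vol ·` (`htableγ`, `hspecα`, `tableBetaP`).
Python exact mirror HOME `pub-omega-stpp-2-g26/code/coverby_mirror.py`: the premise empties the K3 tables at `61` and removes the survivors `29, 30` of
`{(2,3,5),(3,2,5)} @ 59`.  `hHR` is a tree theorem; kills are unconditional.  Nothing here is progress on `ω`.  Refs: CKSU 2005 Def. 5.1; Vosper 1956; H–R 2000.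
-/

open Finset
open scoped Pointwise

namespace Summit.MatrixMultiplication.OmegaCensus.CubeNB
open Literature.Computability.AlgebraicComplexity Literature.Combinatorics.Additive Summit.MatrixMultiplication.OmegaCensus.STPPKneser

section Law
variable {p : ℕ} [hp : Fact p.Prime]

/-- **The slack-1 Vosper law at prime order for a block with `a = 2`, with the exact-cover stage, the Def. 5.1 words and the A-pairing of `W` (kernel).**  See the module docstring; hypotheses as in
`no_isSTPP_of_slack_one_tables_prime_a2` with per-case targets `Jγ, Jα, Jβ` and splits into word ratios or failed cover searches.
[cite: CohnKleinbergSzegedyUmans2005, Def. 5.1] [cite: Vosper1956, main theorem; Nathanson1996, Thm 2.7]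
[cite: HamidouneRodseth2000, main theorem (§1, p. 252); SerraZemor2000, Theorem 3] -/
theorem no_isSTPP_of_slack_one_coverP_prime_a2 {bd : List ℕ → List ℕ → ℕ → ℕ → ℕ → List (List ℕ × List ℕ × List ℕ)} (hbd : BlockEnumSound p bd)
    (hHR : HamidouneRodsethInverseTheorem) {N : ℕ} (A B C : Fin N → Finset (ZMod p))
    (hS : IsSTPP A B C) (hA : ∀ k, (A k).Nonempty) (hB : ∀ k, (B k).Nonempty) (hC : ∀ k, (C k).Nonempty)
    (i : Fin N) (hI : ((univ : Finset (Fin N)).erase i).Nonempty)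
    {a b vol z L m n : ℕ} (ha : #(A i) = a) (hb : #(B i) = b) (hvol : #(A i) * #(B i) * #(C i) = vol)
    (hz : ∑ k ∈ univ.erase i, #(A k) * #(C k) = z) (hL : ∑ k ∈ univ.erase i, #(B k) * #(C k) = L)
    (h2a : a = 2) (h3b : 3 ≤ b) (h4z : 4 ≤ z) (h4L : 4 ≤ L) (hslack : z + b + vol + a + L = p + 1)
    (hm : L + a = m + 1) (hn : vol + m = n)
    (ks : List (Fin N)) (hks : ks.Nodup) (hksi : ∀ k, k ∈ ks ↔ k ≠ i)
    (sAB : List (ℕ × ℕ × ℕ)) (hsAB : sAB = ks.map fun k => (#(A k), #(B k), #(C k)))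
    (sBA : List (ℕ × ℕ × ℕ)) (hsBA : sBA = ks.map fun k => (#(B k), #(A k), #(C k))) (zfirst : Bool)
    {Jγ Jα Jβ : Finset ℕ}
    (htableγ : ∀ j < p, ∀ t < p, (∀ i' < m, (t + j * i') % p < n) →
      (∀ k < m, b ∣ (t + j * k) % p - #((range m).filter fun i' => (t + j * i') % p < (t + j * k) % p)) →
      coverByF p (patN p j a (range b)) vol ((range n).filter fun x => x ∉ (range m).image fun i' => (t + j * i') % p) = true → j ∈ Jγ)
    (hJγ : ∀ jv ∈ Jγ, (jv = 0 ∨ (∃ k ∈ range b, 1 ≤ k ∧ (jv = k ∨ jv + k = p)) ∨ (∃ k ∈ range a, 1 ≤ k ∧ (jv * k % p = 1 ∨ jv * k % p = p - 1))) ∨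
      ∀ ν < z + 1, existsCoverW p ((List.range L).map fun t => (jv * t) % p) ((List.range (z + 1)).filter fun t => decide (t ≠ ν))
          (sAB.map fun s => bd ((List.range L).map fun t => (jv * t) % p) ((List.range (z + 1)).filter fun t => decide (t ≠ ν)) s.1 s.2.1 s.2.2) [] [] [] = false ∨
        existsCoverW p ((List.range (z + 1)).filter fun t => decide (t ≠ ν)) ((List.range L).map fun t => (jv * t) % p)
          (sBA.map fun s => bd ((List.range (z + 1)).filter fun t => decide (t ≠ ν)) ((List.range L).map fun t => (jv * t) % p) s.1 s.2.1 s.2.2) [] [] [] = false)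
    (hspecα : ∀ j < p, ∀ ℓ₁, 1 ≤ ℓ₁ → 2 * ℓ₁ ≤ L → ∀ t₁ < p, ∀ t₂ < p, (∀ i' < ℓ₁ + 1, (t₁ + j * i') % p < n + 1) →
      (∀ i' < L - ℓ₁ + 1, (t₂ + j * i') % p < n + 1) →
      #((range (ℓ₁ + 1)).image (fun i' => (t₁ + j * i') % p) ∪ (range (L - ℓ₁ + 1)).image (fun i' => (t₂ + j * i') % p)) = L + 2 →
      prefixOK b ((range (ℓ₁ + 1)).image (fun i' => (t₁ + j * i') % p) ∪ (range (L - ℓ₁ + 1)).image (fun i' => (t₂ + j * i') % p)) = true →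
      coverByF p (patN p j a (range b)) vol ((range (n + 1)).filter fun x =>
        x ∉ (range (ℓ₁ + 1)).image (fun i' => (t₁ + j * i') % p) ∪ (range (L - ℓ₁ + 1)).image (fun i' => (t₂ + j * i') % p)) = true →
      j ∈ Jα ∨ coverA2E bd p L z sAB sBA zfirst j ℓ₁ ((t₂ + p - t₁) % p) = false)
    (hJα : ∀ jv ∈ Jα, jv = 0 ∨ (∃ k ∈ range b, 1 ≤ k ∧ (jv = k ∨ jv + k = p)) ∨ (∃ k ∈ range a, 1 ≤ k ∧ (jv * k % p = 1 ∨ jv * k % p = p - 1)))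
    (htableβ : tableBetaP p (n + 1) m b a vol Jβ = true)
    (hJβ : ∀ jv ∈ Jβ, (jv = 0 ∨ (∃ k ∈ range b, 1 ≤ k ∧ (jv = k ∨ jv + k = p)) ∨ (∃ k ∈ range a, 1 ≤ k ∧ (jv * k % p = 1 ∨ jv * k % p = p - 1))) ∨
      ((∀ k < b + n + 1, (2 ≤ k ∧ k + 2 ≤ b + n) ∨ k = 0 ∨ k = b + n ∨
          (existsCoverW p ((List.range L).map fun t => (jv * t) % p) (List.range (z - 1) ++ [k + z - 1])
              (sAB.map fun s => bd ((List.range L).map fun t => (jv * t) % p) (List.range (z - 1) ++ [k + z - 1]) s.1 s.2.1 s.2.2) [] [] [] = false ∨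
            existsCoverW p (List.range (z - 1) ++ [k + z - 1]) ((List.range L).map fun t => (jv * t) % p)
              (sBA.map fun s => bd (List.range (z - 1) ++ [k + z - 1]) ((List.range L).map fun t => (jv * t) % p) s.1 s.2.1 s.2.2) [] [] [] = false)) ∧
        (existsCoverW p ((List.range L).map fun t => (jv * t) % p) (List.range z)
            (sAB.map fun s => bd ((List.range L).map fun t => (jv * t) % p) (List.range z) s.1 s.2.1 s.2.2) [] [] [] = false ∨
          existsCoverW p (List.range z) ((List.range L).map fun t => (jv * t) % p)
            (sBA.map fun s => bd (List.range z) ((List.range L).map fun t => (jv * t) % p) s.1 s.2.1 s.2.2) [] [] [] = false))) : False := by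
  have hp2 : 2 ≤ p := hp.out.two_le; have hcardp : Fintype.card (ZMod p) = p := ZMod.card p
  subst hsAB hsBA
  set W := ((A i) ×ˢ ((B i) ×ˢ (C i))).image fun q : ZMod p × ZMod p × ZMod p => (0 : ZMod p) + q.2.2 - q.1 - q.2.1 with hW
  set Sn := (A i).image (fun x => (0 : ZMod p) - x) with hSn
  set Yo := DU B C (univ.erase i) with hYo; set Zo := DU A C (univ.erase i) with hZo
  have hWcard : #W = vol := by rw [hW, card_image_blockSum hS i 0, hvol]
  have hSncard : #Sn = a := by rw [hSn, Finset.card_image_of_injective _ sub_right_injective, ha]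
  have hYocard : #Yo = L := by rw [hYo, card_DU_BC hS hA, hL]
  have hZocard : #Zo = z := by rw [hZo, card_DU_AC hS hB, hz]
  have hfuelC : #(C i) ≤ vol := by
    rw [← hvol]; exact Nat.le_mul_of_pos_left _ (Nat.mul_pos (hA i).card_pos (hB i).card_pos)
  have ha2p : a ≤ p := by omega
  have hSnne : Sn.Nonempty := (hA i).image _; have hYone : Yo.Nonempty := DU_nonempty hI hB hC
  have hWV : Disjoint W (Sn + Yo) := disjoint_W_negA_add_DU hS i
  have hVcard : #(W ∪ (Sn + Yo)) = vol + #(Sn + Yo) := by rw [Finset.card_union_of_disjoint hWV, hWcard]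
  have hsub : B i + (W ∪ (Sn + Yo)) ⊆ univ \ Zo := B_add_W_union_negA_add_subset hS i
  have hvol1 : 1 ≤ vol := by rw [← hvol]; exact Nat.mul_pos (Nat.mul_pos (hA i).card_pos (hB i).card_pos) (hC i).card_pos
  have hU : #(univ \ Zo) = p - z := by
    rw [Finset.card_sdiff_of_subset (Finset.subset_univ _), Finset.card_univ, hcardp, hZocard]
  have hzle : z ≤ p := by have h := Finset.card_le_univ Zo; rwa [hcardp, hZocard] at h
  have hLp : L ≤ p := by have h := Finset.card_le_univ Yo; rwa [hcardp, hYocard] at h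
  have hBV_le : #(B i + (W ∪ (Sn + Yo))) ≤ p - z := hU ▸ Finset.card_le_card hsub
  have hZoU : univ \ (univ \ Zo) = Zo := Finset.sdiff_sdiff_eq_self (Finset.subset_univ _)
  have hWne : W.Nonempty := Finset.card_pos.1 (by rw [hWcard]; exact hvol1)
  have hSY_ne_univ : Sn + Yo ≠ univ := by
    intro h; obtain ⟨x, hx⟩ := hWne
    exact Finset.disjoint_left.1 hWV hx (h ▸ Finset.mem_univ x)
  have hcd1 : #Sn + #Yo ≤ #(Sn + Yo) + 1 := Vosper.cauchy_davenport_of_ne_univ hSnne hYone hSY_ne_univ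
  have hZne : Zo.Nonempty := Finset.card_pos.1 (by rw [hZocard]; omega)
  have hVne : (W ∪ (Sn + Yo)).Nonempty := hWne.mono Finset.subset_union_left
  have hBV_ne_univ : B i + (W ∪ (Sn + Yo)) ≠ univ := by
    intro h; obtain ⟨x, hx⟩ := hZne
    have := hsub (h ▸ Finset.mem_univ x); rw [Finset.mem_sdiff] at this
    exact this.2 hx
  have hcd2 : #(B i) + #(W ∪ (Sn + Yo)) ≤ #(B i + (W ∪ (Sn + Yo))) + 1 :=
    Vosper.cauchy_davenport_of_ne_univ (hB i) hVne hBV_ne_univ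
  rw [hSncard, hYocard] at hcd1; rw [hb, hVcard] at hcd2; have hSYge : m ≤ #(Sn + Yo) := by omega
  have hSYle : #(Sn + Yo) ≤ m + 1 := by omega
  have hmp : m + 2 ≤ p - 4 := by omega
  rcases Nat.eq_or_lt_of_le hSYle with hαcase | hlt
  · have hVn : #(W ∪ (Sn + Yo)) = n + 1 := by rw [hVcard, hαcase]; omega
    have hBVeq : #(B i + (W ∪ (Sn + Yo))) = p - z := by omega
    have hEq : B i + (W ∪ (Sn + Yo)) = univ \ Zo := Finset.eq_of_subset_of_card_le hsub (by rw [hU, hBVeq])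
    have h2B : 2 ≤ #(B i) := by rw [hb]; omega
    have h2V : 2 ≤ #(W ∪ (Sn + Yo)) := by rw [hVn]; omega
    have hcrit2 : #(B i + (W ∪ (Sn + Yo))) = #(B i) + #(W ∪ (Sn + Yo)) - 1 := by rw [hb, hVn]; omega
    have hsmall2 : #(B i + (W ∪ (Sn + Yo))) ≤ p - 2 := by omega
    obtain ⟨e', he', hBap, hVap⟩ := vosper_inverse h2B h2V hcrit2 hsmall2; obtain ⟨β, hβ⟩ := hBap
    obtain ⟨v, hv⟩ := hVap; rw [hb] at hβ; rw [hVn] at hv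
    obtain ⟨α₁, α₂, hα12, hAeq⟩ := Finset.card_eq_two.1 (by rw [ha, h2a] : #(A i) = 2)
    have hSnE : Sn = {(0 : ZMod p) - α₁, ((0 : ZMod p) - α₁) + (α₁ - α₂)} := by
      rw [hSn, hAeq, Finset.image_insert, Finset.image_singleton]
      congr 1
      · rw [show (0 : ZMod p) - α₁ + (α₁ - α₂) = 0 - α₂ by abel]
    set σ : ZMod p := 0 - α₁ with hσ; set s : ZMod p := α₁ - α₂ with hs
    have hs0 : s ≠ 0 := fun h => hα12 (by rw [hs] at h; linear_combination h)
    have hSYeq : Sn + Yo = σ +ᵥ (Yo ∪ (s +ᵥ Yo)) := by rw [hSnE]; exact pair_add_eq_vadd_union σ s Yo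
    have hUcard : #(Yo ∪ (s +ᵥ Yo)) = #Yo + 2 := by
      have h := congrArg Finset.card hSYeq; rw [Finset.card_vadd_finset] at h; rw [← h, hαcase, hYocard]; omega
    obtain ⟨c₁, c₂, ℓ₁, ℓ₂, hℓ1, hℓ12, hℓsum, hYoE⟩ := two_runs_of_card_union_vadd hs0 hUcard
    rw [hYocard] at hℓsum
    have hSYsub : Sn + Yo ⊆ apFinset (σ + c₁) s (ℓ₁ + 1) ∪ apFinset (σ + c₂) s (ℓ₂ + 1) := by
      rw [hSnE, pair_eq_apFinset, hYoE, Finset.add_union]; apply Finset.union_subset_union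
      · have h := apFinset_add_apFinset_subset σ c₁ s 2 ℓ₁
        rwa [show 2 + ℓ₁ - 1 = ℓ₁ + 1 by omega] at h
      · have h := apFinset_add_apFinset_subset σ c₂ s 2 ℓ₂
        rwa [show 2 + ℓ₂ - 1 = ℓ₂ + 1 by omega] at h
    have hSYE : Sn + Yo = apFinset (σ + c₁) s (ℓ₁ + 1) ∪ apFinset (σ + c₂) s (ℓ₂ + 1) := by
      apply Finset.eq_of_subset_of_card_le hSYsub
      have h1 := (Finset.card_union_le _ _).trans (Nat.add_le_add (card_apFinset_le (σ + c₁) s (ℓ₁ + 1)) (card_apFinset_le (σ + c₂) s (ℓ₂ + 1)))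
      rw [hαcase]; omega
    have hApairs : ∀ k, 1 ≤ k → k < a → ∃ α, α ∈ A i ∧ α + k • s ∈ A i := by
      intro k hk1 hk; have hk' : k = 1 := by omega
      subst hk'
      refine ⟨α₂, by rw [hAeq]; simp, ?_⟩
      rw [one_nsmul, hs, show α₂ + (α₁ - α₂) = α₁ by abel, hAeq]; simp
    have hBpairs := pairs_of_apFinset hβ
    obtain ⟨b', rfl⟩ : ∃ b', b = b' + 1 := ⟨b - 1, by omega⟩
    obtain ⟨hSsub', hgap⟩ := prefix_law_of_runs hS i (SY := Sn + Yo) (N₁ := n + 1) he' hβ hWV hv (by omega)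
    have hn1 : n + 1 ≤ p := by omega
    set u : ZMod p := e'⁻¹ with hu; set w : ZMod p := -(e'⁻¹ * v) with hw
    have hSimg : (Sn + Yo).image (fun x => e'⁻¹ * x + -(e'⁻¹ * v)) =
        apFinset (u * (σ + c₁) + w) (u * s) (ℓ₁ + 1) ∪ apFinset (u * (σ + c₂) + w) (u * s) (ℓ₂ + 1) := by
      rw [hSYE, Finset.image_union, image_affine_apFinset, image_affine_apFinset]
    rw [hSimg] at hSsub' hgap; have hj0 : u * s ≠ 0 := mul_ne_zero (inv_ne_zero he') hs0
    have hPS : (apFinset (u * (σ + c₁) + w) (u * s) (ℓ₁ + 1) ∪ apFinset (u * (σ + c₂) + w) (u * s) (ℓ₂ + 1)).image ZMod.val =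
        (range (ℓ₁ + 1)).image (fun i => ((u * (σ + c₁) + w).val + (u * s).val * i) % p) ∪
          (range (L - ℓ₁ + 1)).image (fun i => ((u * (σ + c₂) + w).val + (u * s).val * i) % p) := by
      rw [Finset.image_union, image_val_apFinset, image_val_apFinset, show ℓ₂ = L - ℓ₁ by omega]
    have hpre := prefixOK_of_val hPS hgap
    have hw1 : ∀ i < ℓ₁ + 1, ((u * (σ + c₁) + w).val + (u * s).val * i) % p < n + 1 := by
      intro i hi; rw [← val_add_nsmul_zmod]
      exact (mem_apFinset_zero_one_iff hn1).1 (hSsub' (Finset.mem_union_left _ (mem_apFinset.2 ⟨i, hi, rfl⟩)))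
    have hw2 : ∀ i < L - ℓ₁ + 1, ((u * (σ + c₂) + w).val + (u * s).val * i) % p < n + 1 := by
      intro i hi; rw [← val_add_nsmul_zmod]
      exact (mem_apFinset_zero_one_iff hn1).1 (hSsub' (Finset.mem_union_right _ (mem_apFinset.2 ⟨i, by omega, rfl⟩)))
    have hinjφ : Function.Injective (fun x : ZMod p => e'⁻¹ * x + -(e'⁻¹ * v)) := fun x y h =>
      mul_left_cancel₀ (inv_ne_zero he') (add_right_cancel h)
    have hcardPS : #((range (ℓ₁ + 1)).image (fun i => ((u * (σ + c₁) + w).val + (u * s).val * i) % p) ∪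
        (range (L - ℓ₁ + 1)).image (fun i => ((u * (σ + c₂) + w).val + (u * s).val * i) % p)) = L + 2 := by
      rw [← hPS, Finset.card_image_of_injective _ (ZMod.val_injective p), ← hSimg, Finset.card_image_of_injective _ hinjφ, hαcase]; omega
    have hue0 : u * e' = 1 := inv_mul_cancel₀ he'; have hSn2 : Sn = apFinset σ s a := by rw [hSnE, pair_eq_apFinset, h2a]
    have hBimg : B i = (range (b' + 1)).image (fun δ : ℕ => β + δ • e') := by rw [hβ]; rfl
    have hBD : ∀ δ ∈ range (b' + 1), δ < p := fun δ hδ => by have := Finset.mem_range.1 hδ; omega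
    have hcovP := coverByF_blockSum hS i (w := w) hue0 ha2p hSn2 hBD hBimg hfuelC
    have hTSα : W.image (fun x => e'⁻¹ * x + -(e'⁻¹ * v)) ∪ (Sn + Yo).image (fun x => e'⁻¹ * x + -(e'⁻¹ * v)) = apFinset 0 1 (n + 1) := by
      rw [← Finset.image_union, hv, image_affine_apFinset, hue0, add_neg_cancel]
    have hdisjα : Disjoint (W.image (fun x => e'⁻¹ * x + -(e'⁻¹ * v))) ((Sn + Yo).image (fun x => e'⁻¹ * x + -(e'⁻¹ * v))) :=
      (Finset.disjoint_image hinjφ).2 hWV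
    have hSvalα : ((Sn + Yo).image (fun x => e'⁻¹ * x + -(e'⁻¹ * v))).image ZMod.val =
        (range (ℓ₁ + 1)).image (fun i => ((u * (σ + c₁) + w).val + (u * s).val * i) % p) ∪
          (range (L - ℓ₁ + 1)).image (fun i => ((u * (σ + c₂) + w).val + (u * s).val * i) % p) := by rw [hSimg]; exact hPS
    rw [image_val_eq_filter hn1 hdisjα hTSα hSvalα] at hcovP
    have hval := hspecα (u * s).val (ZMod.val_lt _) ℓ₁ hℓ1 (by omega) _ (ZMod.val_lt _) _ (ZMod.val_lt _) hw1 hw2 hcardPS hpre hcovP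
    rcases hval with hJ | hcov
    · exact false_of_ratio_val_mem_mult hS i hs0 he' (by omega) (by omega) (J := {(e'⁻¹ * s).val})
        (fun jv hjv => by rw [Finset.mem_singleton] at hjv; rw [hjv]; exact hJα _ hJ) (Finset.mem_singleton_self _) hApairs hBpairs (hC i)
    · have hue : u * e' = 1 := inv_mul_cancel₀ he'
      have hBVsub : B i + (W ∪ (Sn + Yo)) ⊆ apFinset (β + v) e' (b' + 1 + n) := by
        have h := apFinset_add_apFinset_subset β v e' (b' + 1) (n + 1); rw [show b' + 1 + (n + 1) - 1 = b' + 1 + n by omega] at h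
        rwa [hβ, hv]
      have hBVE : B i + (W ∪ (Sn + Yo)) = apFinset (β + v) e' (b' + 1 + n) :=
        Finset.eq_of_subset_of_card_le hBVsub ((card_apFinset_le _ _ _).trans (by rw [hBVeq]; omega))
      set z₀ : ZMod p := β + v + (b' + 1 + n) • e' with hz₀
      have hZoE : Zo = apFinset z₀ e' z := by
        rw [← hZoU, ← hEq, hBVE, sdiff_univ_apFinset he' (by omega : b' + 1 + n ≤ p), show p - (b' + 1 + n) = z by omega]
      have hzv := vals_of_apFinset_eq_one hue (by omega : z ≤ p) hZoE
      have hδ : (u * (c₂ - c₁)).val = ((u * (σ + c₂) + w).val + p - (u * (σ + c₁) + w).val) % p := by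
        rw [← val_sub_eq_mod]; congr 1; ring
      have hyv1 := vals_of_indices u c₁ s (List.range ℓ₁) (apFinset c₁ s ℓ₁)
        (fun x hx => by obtain ⟨t, ht, rfl⟩ := mem_apFinset.1 hx; exact ⟨t, List.mem_range.2 ht, rfl⟩)
        (fun t ht => mem_apFinset.2 ⟨t, List.mem_range.1 ht, rfl⟩)
      -- the two runs of `Y°` are disjoint, so the value list is duplicate-free
      have hdisjY : Disjoint (apFinset c₁ s ℓ₁) (apFinset c₂ s ℓ₂) := by
        rw [Finset.disjoint_iff_inter_eq_empty, ← Finset.card_eq_zero]; have h1 := Finset.card_union_add_card_inter (apFinset c₁ s ℓ₁) (apFinset c₂ s ℓ₂)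
        rw [← hYoE, hYocard, card_apFinset hs0 (by omega), card_apFinset hs0 (by omega)] at h1
        omega
      have hYLnd : (twoRunVals p (u * s).val ℓ₁ (((u * (σ + c₂) + w).val + p - (u * (σ + c₁) + w).val) % p) L).Nodup := by
        rw [← hδ]; exact nodup_twoRunVals_of_disjoint (inv_ne_zero he') hs0 hℓsum hLp hdisjY
      have hboth := existsCoverW_both_of_isSTPP_enum hbd hS hA hB hC i ks hks hksi (inv_ne_zero he') (y₀ := c₁) (z₀ := z₀)
        (YL := twoRunVals p (u * s).val ℓ₁ (((u * (σ + c₂) + w).val + p - (u * (σ + c₁) + w).val) % p) L) (ZL := List.range z)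
        hYLnd List.nodup_range
        (fun x hx => by
          have hx' : x ∈ apFinset c₁ s ℓ₁ ∪ apFinset c₂ s ℓ₂ := by rw [← hYoE]; exact hx
          rw [twoRunVals, List.mem_append]
          rcases Finset.mem_union.1 hx' with hx | hx
          · exact Or.inl (hyv1.1 x hx)
          · right
            obtain ⟨t, ht, rfl⟩ := mem_apFinset.1 hx
            refine List.mem_map.2 ⟨t, List.mem_range.2 (by omega), ?_⟩
            rw [← hδ, val_mul_add_nsmul_sub])
        (fun t' ht' => by
          rw [twoRunVals, List.mem_append] at ht'
          rcases ht' with ht' | ht'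
          · obtain ⟨x, hx, hxv⟩ := hyv1.2 t' ht'
            have hxYo : x ∈ Yo := by rw [hYoE]; exact Finset.mem_union_left _ hx
            exact ⟨x, hxYo, hxv⟩
          · obtain ⟨t, ht, rfl⟩ := List.mem_map.1 ht'
            rw [List.mem_range] at ht; have hxYo : c₂ + t • s ∈ Yo := by rw [hYoE]; exact Finset.mem_union_right _ (mem_apFinset.2 ⟨t, by omega, rfl⟩)
            exact ⟨c₂ + t • s, hxYo, by rw [← hδ, val_mul_add_nsmul_sub]⟩)
        hzv.1 hzv.2
      revert hcov
      rw [coverA2E]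
      cases zfirst
      · rw [if_neg (by decide), map_sizes_bd A B C bd, hboth.1]; exact Bool.noConfusion
      · rw [if_pos rfl, map_sizes_bd B A C bd, hboth.2]; exact Bool.noConfusion
  · have hSYm : #(Sn + Yo) = m := by omega
    have hVn : #(W ∪ (Sn + Yo)) = n := by rw [hVcard, hSYm, hn]
    have h2S : 2 ≤ #Sn := by rw [hSncard]; omega
    have h2Yo : 2 ≤ #Yo := by rw [hYocard]; omega
    have hcrit1 : #(Sn + Yo) = #Sn + #Yo - 1 := by rw [hSncard, hYocard]; omega
    have hsmall1 : #(Sn + Yo) ≤ p - 2 := by omega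
    obtain ⟨d, hd, hSap, hYap⟩ := vosper_inverse h2S h2Yo hcrit1 hsmall1; obtain ⟨s₀, hs₀⟩ := hSap
    obtain ⟨y₀, hy⟩ := hYap; rw [hSncard] at hs₀; rw [hYocard] at hy
    have hsubm : Sn + Yo ⊆ apFinset (s₀ + y₀) d m := by
      have h := apFinset_add_apFinset_subset s₀ y₀ d a L; rw [show a + L - 1 = m by omega] at h
      rwa [hs₀, hy]
    have hSY : Sn + Yo = apFinset (s₀ + y₀) d m :=
      Finset.eq_of_subset_of_card_le hsubm (by rw [hSYm, card_apFinset hd (by omega)])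
    have hApairs : ∀ k, 1 ≤ k → k < a → ∃ α, α ∈ A i ∧ α + k • d ∈ A i :=
      pairs_of_neg_image (A := A) i (pairs_of_apFinset hs₀)
    rcases Nat.eq_or_lt_of_le hBV_le with hβcase | hγlt
    · have hEq : B i + (W ∪ (Sn + Yo)) = univ \ Zo := Finset.eq_of_subset_of_card_le hsub (by rw [hU, hβcase])
      have hHR2 := hHR p (B i) (W ∪ (Sn + Yo)) (by rw [hb]; omega) (by rw [hVn]; omega) (by omega) (by omega)
        (by rw [hb, hVn]; omega)
      obtain ⟨e', β, v, hBsub, hVsub⟩ := hHR2; rw [hb] at hBsub; rw [hVn] at hVsub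
      have he' : e' ≠ 0 := step_ne_zero_of_subset_apFinset hBsub (by rw [hb]; omega)
      obtain ⟨g, hg, hBE⟩ := eq_apErase_of_subset_apFinset he' (by omega : b + 1 ≤ p) hBsub (by rw [hb])
      obtain ⟨β₁, g₁, hg₁, hBE₁⟩ : ∃ β₁ : ZMod p, ∃ g₁ : ℕ, g₁ < b ∧ B i = apErase β₁ e' (b + 1) g₁ := by
        rcases Nat.lt_or_ge g b with hgb | hgb
        · exact ⟨β, g, hgb, hBE⟩
        · have hgb' : g = b := by omega
          obtain ⟨b', rfl⟩ : ∃ b', b = b' + 1 := ⟨b - 1, by omega⟩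
          refine ⟨β - e', 0, by omega, ?_⟩
          rw [hBE, hgb', apErase_last_eq_apErase_zero]
      have hBpairs : ∀ k, 1 ≤ k → k < b → ∃ β, β ∈ B i ∧ β + k • e' ∈ B i :=
        fun k hk1 hk => pairs_of_apErase hBE₁ (by omega) k hk1 (by omega)
      have hPcard : #((A i) ×ˢ (C i)) ≤ n + 1 := by
        rw [Finset.card_product]
        have h1 : #(A i) * #(C i) ≤ #(A i) * #(B i) * #(C i) := by
          rw [mul_assoc, mul_comm (#(B i)) _, ← mul_assoc]; exact Nat.le_mul_of_pos_right _ (hB i).card_pos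
        rw [hvol] at h1; omega
      have hval := holed_ratio_val_memP hS i (J := Jβ) he' hd hg₁ hBE₁ ha2p hs₀ hfuelC hSY hWV hVsub hVn (by omega) hPcard
        (tableBetaP_spec htableβ)
      rcases hJβ _ hval with hJ | ⟨hcovk, hcovrun⟩
      · exact false_of_ratio_val_mem_mult hS i hd he' (by omega) (by omega) (J := {(e'⁻¹ * d).val})
          (fun jv hjv => by rw [Finset.mem_singleton] at hjv; rw [hjv]; exact hJ) (Finset.mem_singleton_self _) hApairs hBpairs (hC i)
      · set u : ZMod p := e'⁻¹ with hu
        have hue : u * e' = 1 := inv_mul_cancel₀ he'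
        obtain ⟨h, -, hVE⟩ := eq_apErase_of_subset_apFinset he' (by omega : n + 1 ≤ p) hVsub (by rw [hVn])
        have hBVsubP : B i + (W ∪ (Sn + Yo)) ⊆ apFinset (β₁ + v) e' (b + n + 1) := by
          have h1 := Finset.add_subset_add (apErase_subset_apFinset β₁ e' (b + 1) g₁) (apErase_subset_apFinset v e' (n + 1) h); rw [← hBE₁, ← hVE] at h1
          have h2 := apFinset_add_apFinset_subset β₁ v e' (b + 1) (n + 1); rw [show b + 1 + (n + 1) - 1 = b + n + 1 by omega] at h2
          exact h1.trans h2
        set z₀ : ZMod p := β₁ + v + (b + n + 1) • e' with hz₀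
        have hzbn : z + b + n = p := by omega
        have hQE : (univ : Finset (ZMod p)) \ apFinset (β₁ + v) e' (b + n + 1) = apFinset z₀ e' (z - 1) := by
          rw [sdiff_univ_apFinset he' (by omega : b + n + 1 ≤ p), show p - (b + n + 1) = z - 1 by omega]
        have hQsub : apFinset z₀ e' (z - 1) ⊆ Zo := by
          intro x hx; rw [← hQE, Finset.mem_sdiff] at hx
          by_contra hxZo
          exact hx.2 (hBVsubP (by rw [hEq, Finset.mem_sdiff]; exact ⟨Finset.mem_univ x, hxZo⟩))
        have hQcard : #(apFinset z₀ e' (z - 1)) = z - 1 := card_apFinset he' (by omega)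
        obtain ⟨q, hqZo, hqQ, hZoiff⟩ := exists_eq_sdiff_singleton hQsub (by rw [hZocard, hQcard]; omega)
        have hqP : q ∈ apFinset (β₁ + v) e' (b + n + 1) := by
          by_contra hq
          exact hqQ (by rw [← hQE, Finset.mem_sdiff]; exact ⟨Finset.mem_univ q, hq⟩)
        obtain ⟨k, hk, hqk⟩ := mem_apFinset.1 hqP
        have hqnot : q ∉ B i + (W ∪ (Sn + Yo)) := by
          rw [hEq, Finset.mem_sdiff]; exact fun hh => hh.2 hqZo
        have hZoQ : ∀ x ∈ Zo, x ≠ q → x ∈ apFinset z₀ e' (z - 1) := fun x hx hxq => (hZoiff x).2 ⟨hx, hxq⟩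
        have hQZo : ∀ x ∈ apFinset z₀ e' (z - 1), x ∈ Zo := fun x hx => ((hZoiff x).1 hx).1
        have hpe : (p : ℕ) • e' = 0 := by rw [nsmul_eq_mul, ZMod.natCast_self, zero_mul]
        have hqz : q = z₀ + (k + z - 1) • e' := by
          rw [← hqk, hz₀, add_assoc (β₁ + v), ← add_nsmul, show b + n + 1 + (k + z - 1) = p + k by omega, add_nsmul, hpe,
            zero_add]
        obtain ⟨z₁, TL, hTLp, hTLnd, hT1, hT2, hcov⟩ : ∃ z₁ : ZMod p, ∃ TL : List ℕ, (∀ t ∈ TL, t < p) ∧ TL.Nodup ∧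
            (∀ x ∈ Zo, ∃ t ∈ TL, x = z₁ + t • e') ∧ (∀ t ∈ TL, z₁ + t • e' ∈ Zo) ∧
            (existsCoverW p ((List.range L).map fun t => ((u * d).val * t) % p) TL
                (ks.map fun k => bd ((List.range L).map fun t => ((u * d).val * t) % p) TL #(A k) #(B k) #(C k)) [] [] [] = false ∨
              existsCoverW p TL ((List.range L).map fun t => ((u * d).val * t) % p)
                (ks.map fun k => bd TL ((List.range L).map fun t => ((u * d).val * t) % p) #(B k) #(A k) #(C k)) [] [] [] = false) := by
          rcases hcovk k hk with hmid | hk0 | hkbn | hcovg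
          · exact absurd (mem_add_of_apErase_apErase hBE₁ hVE h3b (by omega) hmid.1 hmid.2) (hqk ▸ hqnot)
          · obtain ⟨z₁, hT1, hT2⟩ := exists_run_indices (c := b + n) (by omega) (by omega) (Or.inl hk0) hqz hqZo hZoQ hQZo
            rw [map_sizes_bd A B C bd, map_sizes_bd B A C bd] at hcovrun
            exact ⟨z₁, List.range z, fun t ht => by rw [List.mem_range] at ht; omega, List.nodup_range, hT1, hT2, hcovrun⟩
          · obtain ⟨z₁, hT1, hT2⟩ := exists_run_indices (c := b + n) (by omega) (by omega) (Or.inr hkbn) hqz hqZo hZoQ hQZo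
            rw [map_sizes_bd A B C bd, map_sizes_bd B A C bd] at hcovrun
            exact ⟨z₁, List.range z, fun t ht => by rw [List.mem_range] at ht; omega, List.nodup_range, hT1, hT2, hcovrun⟩
          · obtain ⟨hT1, hT2⟩ := exists_point_indices hqz hqZo hZoQ hQZo
            rw [map_sizes_bd A B C bd, map_sizes_bd B A C bd] at hcovg
            exact ⟨z₀, _, fun t ht => by rw [List.mem_append, List.mem_range, List.mem_singleton] at ht; omega,
              nodup_range_append_singleton (by omega), hT1, hT2, hcovg⟩
        have hzv := vals_of_indices_one hue z₁ TL hTLp Zo hT1 hT2; have hyv := vals_of_apFinset_eq u hy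
        have hYLnd := nodup_range_map_mul_val (u * d) (mul_ne_zero (inv_ne_zero he') hd) hLp
        have hboth := existsCoverW_both_of_isSTPP_enum hbd hS hA hB hC i ks hks hksi (inv_ne_zero he') hYLnd hTLnd hyv.1 hyv.2 hzv.1 hzv.2
        rcases hcov with hcov | hcov
        · rw [hcov] at hboth; exact Bool.noConfusion hboth.1
        · rw [hcov] at hboth; exact Bool.noConfusion hboth.2
    · have hBVeq : #(B i + (W ∪ (Sn + Yo))) = b + n - 1 := by omega
      have h2B : 2 ≤ #(B i) := by rw [hb]; omega
      have h2V : 2 ≤ #(W ∪ (Sn + Yo)) := by rw [hVn]; omega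
      have hcrit2 : #(B i + (W ∪ (Sn + Yo))) = #(B i) + #(W ∪ (Sn + Yo)) - 1 := by rw [hb, hVn]; omega
      have hsmall2 : #(B i + (W ∪ (Sn + Yo))) ≤ p - 2 := by omega
      obtain ⟨e', he', hBap, hVap⟩ := vosper_inverse h2B h2V hcrit2 hsmall2; obtain ⟨β, hβ⟩ := hBap
      obtain ⟨v, hv⟩ := hVap; rw [hb] at hβ; rw [hVn] at hv
      have hBpairs := pairs_of_apFinset hβ
      obtain ⟨b', rfl⟩ : ∃ b', b = b' + 1 := ⟨b - 1, by omega⟩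
      obtain ⟨hSsub', hgap⟩ := prefix_law_of_runs hS i (SY := Sn + Yo) (N₁ := n) he' hβ hWV hv (by omega)
      rw [hSY, image_affine_apFinset] at hSsub' hgap; have hue0 : e'⁻¹ * e' = 1 := inv_mul_cancel₀ he'
      have hφinjγ : Function.Injective (fun x : ZMod p => e'⁻¹ * x + -(e'⁻¹ * v)) := affine_injective (inv_ne_zero he') _
      have hBimg : B i = (range (b' + 1)).image (fun δ : ℕ => β + δ • e') := by rw [hβ]; rfl
      have hBD : ∀ δ ∈ range (b' + 1), δ < p := fun δ hδ => by have := Finset.mem_range.1 hδ; omega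
      have hcovP := coverByF_blockSum hS i (w := -(e'⁻¹ * v)) hue0 ha2p hs₀ hBD hBimg hfuelC
      have hTSγ : W.image (fun x => e'⁻¹ * x + -(e'⁻¹ * v)) ∪ (Sn + Yo).image (fun x => e'⁻¹ * x + -(e'⁻¹ * v)) = apFinset 0 1 n := by
        rw [← Finset.image_union, hv, image_affine_apFinset, hue0, add_neg_cancel]
      have hdisjγ : Disjoint (W.image (fun x => e'⁻¹ * x + -(e'⁻¹ * v))) ((Sn + Yo).image (fun x => e'⁻¹ * x + -(e'⁻¹ * v))) :=
        (Finset.disjoint_image hφinjγ).2 hWV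
      have hSvalγ : ((Sn + Yo).image (fun x => e'⁻¹ * x + -(e'⁻¹ * v))).image ZMod.val =
          (range m).image (fun k => ((e'⁻¹ * (s₀ + y₀) + -(e'⁻¹ * v)).val + (e'⁻¹ * d).val * k) % p) := by
        rw [hSY, image_affine_apFinset]; exact image_val_apFinset' _ _ m
      rw [image_val_eq_filter (by omega : n ≤ p) hdisjγ hTSγ hSvalγ] at hcovP
      have hval := val_mem_of_nat_tableX_prime (p := p) (n := n) (m := m) (r := b' + 1) (J := Jγ) (by omega) (by omega)
        (fun j t => coverByF p (patN p j a (range (b' + 1))) vol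
          ((range n).filter fun x => x ∉ (range m).image fun i' => (t + j * i') % p) = true)
        htableγ (mul_ne_zero (inv_ne_zero he') hd) hSsub' hgap hcovP
      rcases hJγ _ hval with hJ | hcovν
      · exact false_of_ratio_val_mem_mult hS i hd he' (by omega) (by omega) (J := {(e'⁻¹ * d).val})
          (fun jv hjv => by rw [Finset.mem_singleton] at hjv; rw [hjv]; exact hJ) (Finset.mem_singleton_self _) hApairs hBpairs (hC i)
      · set u : ZMod p := e'⁻¹ with hu
        have hue : u * e' = 1 := inv_mul_cancel₀ he'
        have hBVsub : B i + (W ∪ (Sn + Yo)) ⊆ apFinset (β + v) e' (b' + n) := by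
          have h := apFinset_add_apFinset_subset β v e' (b' + 1) n; rw [show b' + 1 + n - 1 = b' + n by omega] at h
          rwa [hβ, hv]
        have hBVE : B i + (W ∪ (Sn + Yo)) = apFinset (β + v) e' (b' + n) :=
          Finset.eq_of_subset_of_card_le hBVsub ((card_apFinset_le _ _ _).trans (by rw [hBVeq]; omega))
        set z₀ : ZMod p := β + v + (b' + n) • e' with hz₀
        have hzbn : z + b' + n + 1 = p := by omega
        have hZosub : Zo ⊆ apFinset z₀ e' (z + 1) := by
          have h1 : Zo ⊆ univ \ (B i + (W ∪ (Sn + Yo))) := by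
            intro x hx; rw [Finset.mem_sdiff]
            refine ⟨Finset.mem_univ x, fun hxBV => ?_⟩
            have h2 := hsub hxBV; rw [Finset.mem_sdiff] at h2
            exact h2.2 hx
          rw [hBVE, sdiff_univ_apFinset he' (by omega : b' + n ≤ p), show p - (b' + n) = z + 1 by omega] at h1
          exact h1
        have hQcard : #(apFinset z₀ e' (z + 1)) = z + 1 := card_apFinset he' (by omega)
        obtain ⟨q, hqQ, hqZo, hZoiff⟩ := exists_eq_sdiff_singleton hZosub (by rw [hZocard, hQcard])
        obtain ⟨ν, hν, hqν⟩ := mem_apFinset.1 hqQ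
        have hzv := vals_of_indices_one hue z₀ ((List.range (z + 1)).filter fun t => decide (t ≠ ν))
          (fun t ht => by rw [List.mem_filter, List.mem_range] at ht; omega) Zo
          (fun x hx => by
            obtain ⟨hxQ, hxq⟩ := (hZoiff x).1 hx; obtain ⟨t, ht, rfl⟩ := mem_apFinset.1 hxQ
            refine ⟨t, List.mem_filter.2 ⟨List.mem_range.2 ht, ?_⟩, rfl⟩
            rw [decide_eq_true_eq]; rintro rfl
            exact hxq hqν)
          (fun t ht => by
            rw [List.mem_filter, List.mem_range, decide_eq_true_eq] at ht
            refine (hZoiff _).2 ⟨mem_apFinset.2 ⟨t, ht.1, rfl⟩, fun heq => ht.2 ?_⟩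
            exact zmod_natMul_injOn he' (by omega) (by omega) (heq.trans hqν.symm))
        have hyv := vals_of_apFinset_eq u hy; have hYLnd := nodup_range_map_mul_val (u * d) (mul_ne_zero (inv_ne_zero he') hd) hLp
        have hZLnd : ((List.range (z + 1)).filter fun t => decide (t ≠ ν)).Nodup := List.nodup_range.filter _
        have hboth := existsCoverW_both_of_isSTPP_enum hbd hS hA hB hC i ks hks hksi (inv_ne_zero he') hYLnd hZLnd hyv.1 hyv.2 hzv.1 hzv.2
        rcases hcovν ν hν with hcov | hcov
        · rw [map_sizes_bd A B C bd] at hcov; rw [hcov] at hboth; exact Bool.noConfusion hboth.1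
        · rw [map_sizes_bd B A C bd] at hcov; rw [hcov] at hboth; exact Bool.noConfusion hboth.2

end Law
end Summit.MatrixMultiplication.OmegaCensus.CubeNB
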